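import Summits.CriticalPhenomena.Ising3DConformalLimit.Theorems.LogPolarProxyExistsContinuousLimitLimitContinuity
import Summits.CriticalPhenomena.Ising3DConformalLimit.Theorems.ExistsScaleCovariantLimit.Negative.PureExistence
import Summits.CriticalPhenomena.Ising3DConformalLimit.Theorems.MoebiusLimitExists.Negative.OnlyInteractionTightness
import Summits.CriticalPhenomena.Ising3DConformalLimit.Theorems.ConformalPoissonDeviceDeviceWeylUniversalityStubLimitZero
import HarnessLib

/-!
# `ExistsContinuousLimit` (item stmt-CriticalPhenomena-4582): load-bearing table of the eight clauses

Negative / structural knowledge about the crux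
`Summit.CriticalPhenomena.Ising3DConformalLimit.Theses.ReflectionTwin.ExistsContinuousLimit`
(the same term as `LogPolarProxy.ExistsContinuousLimit`), from the standing crux disprover's work file
`Cruxes/ExistsContinuousLimit/Disproof.lean` (cycle 1); THEOREM-ONLY (no definitions, no named facts: the
dropped-clause variants and the two model families are written inline). No theorem here asserts a route item.

The crux is `∃ ρ Δ S, (1) ρ > 0 on (0,1] ∧ (2) 0 < Δ ∧ (3) HasPointwiseScalingLimit (criticalCorr 3) ρ S ∧
(4) S = 0 off NonCoincident ∧ (5) ∀ n, ContinuousOn (S n) (NonCoincident 3 n) ∧ (6) IsNondegenerateTwoPoint S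
∧ (7) IsTranslationInvariant S ∧ (8) IsScaleCovariant Δ S`.

* `existsContinuousLimit_iff_core`: **crux ⟺ ∃ ρ S, limit ∧ S₂ ≠ 0 at ONE non-coincident pair** (the alias
  crux ⟺ stmt-1981, p146967, composed with the sibling's `PureExistence.iff_pure_existence`);
  `not_existsContinuousLimit_iff`: a disproof must kill EVERY renormalised pointwise limit at every pair.
* IDLE CLAUSES — dropping any one of (1) (2) (4) (5) (7) (8) leaves a statement still EQUIVALENT to the
  crux: `existsContinuousLimit_iff_without_rhoPos`, `…_without_deltaPos`, `…_without_normalisation`,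
  `…_without_continuity` (this one is stmt-1981 itself), `…_without_translation`, `…_without_scale`.
* LOAD-BEARING CLAUSES — (3) and (6), each useless without the other:
  `existsContinuousLimit_without_nondeg_holds` (all clauses but (6) hold for the GENUINE degenerate scaling
  limit `S₀ = 1, Sₙ = 0 (n ≥ 1)` of `criticalCorr 3` under `ρ(δ) = δ`, `hasPointwiseScalingLimit_trivial`),
  `existsContinuousLimit_without_limit_holds` (all clauses but (3) hold for the explicit power family
  `Sₙ(x) = (∑ᵢⱼ ‖xᵢ − xⱼ‖)^{−nΔ}` on `NonCoincident`, `0` elsewhere — a non-junk model of the clause bundle).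
  Reading: every bit of content of the crux is "the full-filter limit EXISTS and is NON-ZERO at one pair" —
  the open existence problem (Duminil-Copin, ICM 2022, §8.4 p. 29) and nothing else.

References: H. Duminil-Copin, Proc. ICM 2022, §8.4 p. 29 [DuminilCopinICM2022]; tree files
`Theorems/LogPolarProxyExistsContinuousLimitLimitContinuity.lean` (p146967),
`Theorems/ExistsScaleCovariantLimit/Negative/PureExistence.lean`.
-/

noncomputable section

namespace Summit.CriticalPhenomena.Ising3DConformalLimit.ExistsContinuousLimitNegative

open Literature.Probability.LatticeModels Filter Set
open scoped Topology
open Summit.CriticalPhenomena.Ising3DConformalLimit.Theses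
open Summit.CriticalPhenomena.Ising3DConformalLimit.LogPolarProxyExistsContinuousLimit
  (reflectionTwin_existsContinuousLimit_iff_existsScaleCovariantLimit)
open Summit.CriticalPhenomena.Ising3DConformalLimit.ExistsScaleCovariantLimitNegative (iff_pure_existence)
open Summit.CriticalPhenomena.Ising3DConformalLimit.MoebiusLimitExistsNegative
  (smul_mem_nonCoincident_iff add_mem_nonCoincident_iff)
open Summit.CriticalPhenomena.Ising3DConformalLimit.OnlyInteractionTightness (abs_rescaledCorrelator_le)
open Summit.CriticalPhenomena.Ising3DConformalLimit.Theorems.DeviceWeylUniversality.StubLimitZero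
  (rescaledCorrelator_criticalCorr_zero)
open Classical

/-! ### The core -/

/-- **crux ⟺ core**: `ReflectionTwin.ExistsContinuousLimit` holds iff SOME full-filter pointwise scaling
limit of the critical `ℤ³` correlators, under some renormalisation, is non-zero at one non-coincident pair.
All of (1) (2) (4) (5) (7) (8) and non-degeneracy beyond one pair are consequences.
[cite: DuminilCopinICM2022, §8.4 p. 29] -/
theorem existsContinuousLimit_iff_core :
    ReflectionTwin.ExistsContinuousLimit ↔
      ∃ (ρ : ℝ → ℝ) (S : CorrFamily 3), HasPointwiseScalingLimit (criticalCorr 3) ρ S ∧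
        ∃ x ∈ NonCoincident 3 2, S 2 x ≠ 0 :=
  reflectionTwin_existsContinuousLimit_iff_existsScaleCovariantLimit.trans iff_pure_existence

/-- **What a disproof must show**: every pointwise scaling limit of `criticalCorr 3`, under any
renormalisation, vanishes at every non-coincident pair. [folklore] -/
theorem not_existsContinuousLimit_iff :
    ¬ ReflectionTwin.ExistsContinuousLimit ↔
      ∀ (ρ : ℝ → ℝ) (S : CorrFamily 3), HasPointwiseScalingLimit (criticalCorr 3) ρ S →
        ∀ x ∈ NonCoincident 3 2, S 2 x = 0 := by
  rw [existsContinuousLimit_iff_core]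
  push Not
  exact Iff.rfl

/-- From a limit and non-degeneracy to the core (forgetting; the step behind every idle-clause
equivalence below). [folklore] -/
theorem core_of_limit_nondeg {ρ : ℝ → ℝ} {S : CorrFamily 3}
    (hlim : HasPointwiseScalingLimit (criticalCorr 3) ρ S) (hnd : IsNondegenerateTwoPoint S) :
    ∃ (ρ : ℝ → ℝ) (S : CorrFamily 3), HasPointwiseScalingLimit (criticalCorr 3) ρ S ∧
      ∃ x ∈ NonCoincident 3 2, S 2 x ≠ 0 :=
  ⟨ρ, S, hlim, _, zero_unitVec_mem_nonCoincident one_ne_zero,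
    (hnd _ (zero_unitVec_mem_nonCoincident one_ne_zero)).ne'⟩

/-! ### Idle clauses: drop one, the statement is still the crux -/

/-- (1) `ρ > 0 on (0,1]` is idle. [folklore] -/
theorem existsContinuousLimit_iff_without_rhoPos :
    ReflectionTwin.ExistsContinuousLimit ↔
      ∃ (ρ : ℝ → ℝ) (Δ : ℝ) (S : CorrFamily 3), 0 < Δ ∧ HasPointwiseScalingLimit (criticalCorr 3) ρ S ∧
        (∀ n z, z ∉ NonCoincident 3 n → S n z = 0) ∧ (∀ n, ContinuousOn (S n) (NonCoincident 3 n)) ∧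
        IsNondegenerateTwoPoint S ∧ IsTranslationInvariant S ∧ IsScaleCovariant Δ S := by
  refine ⟨?_, ?_⟩
  · rintro ⟨ρ, Δ, S, -, hΔ, hlim, hz, hc, hnd, htr, hsc⟩
    exact ⟨ρ, Δ, S, hΔ, hlim, hz, hc, hnd, htr, hsc⟩
  · rintro ⟨ρ, Δ, S, -, hlim, -, -, hnd, -, -⟩
    exact existsContinuousLimit_iff_core.2 (core_of_limit_nondeg hlim hnd)

/-- (2) `0 < Δ` is idle (`Δ` is an output, forced into `[1/2, 3/4]`). [folklore] -/
theorem existsContinuousLimit_iff_without_deltaPos :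
    ReflectionTwin.ExistsContinuousLimit ↔
      ∃ (ρ : ℝ → ℝ) (Δ : ℝ) (S : CorrFamily 3), (∀ δ ∈ Set.Ioc (0:ℝ) 1, 0 < ρ δ) ∧
        HasPointwiseScalingLimit (criticalCorr 3) ρ S ∧
        (∀ n z, z ∉ NonCoincident 3 n → S n z = 0) ∧ (∀ n, ContinuousOn (S n) (NonCoincident 3 n)) ∧
        IsNondegenerateTwoPoint S ∧ IsTranslationInvariant S ∧ IsScaleCovariant Δ S := by
  refine ⟨?_, ?_⟩
  · rintro ⟨ρ, Δ, S, hρ, -, hlim, hz, hc, hnd, htr, hsc⟩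
    exact ⟨ρ, Δ, S, hρ, hlim, hz, hc, hnd, htr, hsc⟩
  · rintro ⟨ρ, Δ, S, -, hlim, -, -, hnd, -, -⟩
    exact existsContinuousLimit_iff_core.2 (core_of_limit_nondeg hlim hnd)

/-- (4) the normalisation off `NonCoincident` is idle. [folklore] -/
theorem existsContinuousLimit_iff_without_normalisation :
    ReflectionTwin.ExistsContinuousLimit ↔
      ∃ (ρ : ℝ → ℝ) (Δ : ℝ) (S : CorrFamily 3), (∀ δ ∈ Set.Ioc (0:ℝ) 1, 0 < ρ δ) ∧ 0 < Δ ∧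
        HasPointwiseScalingLimit (criticalCorr 3) ρ S ∧ (∀ n, ContinuousOn (S n) (NonCoincident 3 n)) ∧
        IsNondegenerateTwoPoint S ∧ IsTranslationInvariant S ∧ IsScaleCovariant Δ S := by
  refine ⟨?_, ?_⟩
  · rintro ⟨ρ, Δ, S, hρ, hΔ, hlim, -, hc, hnd, htr, hsc⟩
    exact ⟨ρ, Δ, S, hρ, hΔ, hlim, hc, hnd, htr, hsc⟩
  · rintro ⟨ρ, Δ, S, -, -, hlim, -, hnd, -, -⟩
    exact existsContinuousLimit_iff_core.2 (core_of_limit_nondeg hlim hnd)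

/-- (5) continuity on `NonCoincident` is idle: without it the statement is stmt-1981
`HyperoctahedralRP.ExistsScaleCovariantLimit` VERBATIM, equivalent to the crux by p146967 (mesh continuity).
The route docstring's step function `1_{x₁ ≥ 0}` is a pointwise limit of its OWN discretisation, but that
lattice family is not translation invariant — `criticalCorr 3` is. [folklore] -/
theorem existsContinuousLimit_iff_without_continuity :
    ReflectionTwin.ExistsContinuousLimit ↔
      ∃ (ρ : ℝ → ℝ) (Δ : ℝ) (S : CorrFamily 3), (∀ δ ∈ Set.Ioc (0:ℝ) 1, 0 < ρ δ) ∧ 0 < Δ ∧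
        HasPointwiseScalingLimit (criticalCorr 3) ρ S ∧ (∀ n z, z ∉ NonCoincident 3 n → S n z = 0) ∧
        IsNondegenerateTwoPoint S ∧ IsTranslationInvariant S ∧ IsScaleCovariant Δ S :=
  reflectionTwin_existsContinuousLimit_iff_existsScaleCovariantLimit

/-- (7) translation invariance is idle (free for every full-filter limit). [folklore] -/
theorem existsContinuousLimit_iff_without_translation :
    ReflectionTwin.ExistsContinuousLimit ↔
      ∃ (ρ : ℝ → ℝ) (Δ : ℝ) (S : CorrFamily 3), (∀ δ ∈ Set.Ioc (0:ℝ) 1, 0 < ρ δ) ∧ 0 < Δ ∧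
        HasPointwiseScalingLimit (criticalCorr 3) ρ S ∧ (∀ n z, z ∉ NonCoincident 3 n → S n z = 0) ∧
        (∀ n, ContinuousOn (S n) (NonCoincident 3 n)) ∧ IsNondegenerateTwoPoint S ∧
        IsScaleCovariant Δ S := by
  refine ⟨?_, ?_⟩
  · rintro ⟨ρ, Δ, S, hρ, hΔ, hlim, hz, hc, hnd, -, hsc⟩
    exact ⟨ρ, Δ, S, hρ, hΔ, hlim, hz, hc, hnd, hsc⟩
  · rintro ⟨ρ, Δ, S, -, -, hlim, -, -, hnd, -⟩
    exact existsContinuousLimit_iff_core.2 (core_of_limit_nondeg hlim hnd)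

/-- (8) scale covariance (and with it `Δ`) is idle: some `Δ ∈ [1/2, 3/4]` always works
(Messager–Miracle-Solé monotonicity + the Cauchy equation, sibling `ScaleRedundant`). [folklore] -/
theorem existsContinuousLimit_iff_without_scale :
    ReflectionTwin.ExistsContinuousLimit ↔
      ∃ (ρ : ℝ → ℝ) (S : CorrFamily 3), (∀ δ ∈ Set.Ioc (0:ℝ) 1, 0 < ρ δ) ∧
        HasPointwiseScalingLimit (criticalCorr 3) ρ S ∧ (∀ n z, z ∉ NonCoincident 3 n → S n z = 0) ∧
        (∀ n, ContinuousOn (S n) (NonCoincident 3 n)) ∧ IsNondegenerateTwoPoint S ∧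
        IsTranslationInvariant S := by
  refine ⟨?_, ?_⟩
  · rintro ⟨ρ, Δ, S, hρ, -, hlim, hz, hc, hnd, htr, -⟩
    exact ⟨ρ, S, hρ, hlim, hz, hc, hnd, htr⟩
  · rintro ⟨ρ, S, -, hlim, -, -, hnd, -⟩
    exact existsContinuousLimit_iff_core.2 (core_of_limit_nondeg hlim hnd)

/-! ### (6) is load-bearing: without non-degeneracy the statement is TRUE (trivial limit) -/

/-- **The critical `ℤ³` correlators renormalised by `ρ(δ) = δ` converge** — to the trivial family
`S₀ = 1`, `Sₙ = 0` (`n ≥ 1`): `|⟨∏σ⟩_{β_c}| ≤ 1` kills every order `n ≥ 1`, and `⟨1⟩ = 1` at `n = 0`;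
the convergence is even uniform. A genuine, degenerate, full-filter scaling limit of `criticalCorr 3`. [folklore] -/
theorem hasPointwiseScalingLimit_trivial :
    HasPointwiseScalingLimit (criticalCorr 3) (fun δ => δ)
      (fun n _ => if n = 0 then 1 else 0) := by
  intro n
  refine TendstoUniformlyOn.tendstoLocallyUniformlyOn (Metric.tendstoUniformlyOn_iff.2 fun ε hε => ?_)
  rcases Nat.eq_zero_or_pos n with rfl | hn
  · filter_upwards with δ x _
    rw [rescaledCorrelator_criticalCorr_zero]
    simp [hε]
  · filter_upwards [Ioo_mem_nhdsGT (show (0:ℝ) < min ε 1 from lt_min hε one_pos)] with δ hδ x _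
    have hδ0 : 0 < δ := hδ.1
    have hδε : δ < ε := lt_of_lt_of_le hδ.2 (min_le_left _ _)
    have hδ1 : δ < 1 := lt_of_lt_of_le hδ.2 (min_le_right _ _)
    rw [if_neg hn.ne', Real.dist_eq, zero_sub, abs_neg]
    calc |rescaledCorrelator (criticalCorr 3) (fun δ => δ) n δ x| ≤ |δ| ^ n :=
          abs_rescaledCorrelator_le _ n δ x
      _ ≤ |δ| := by
          rw [abs_of_pos hδ0]
          exact pow_le_of_le_one hδ0.le hδ1.le hn.ne'
      _ < ε := by rwa [abs_of_pos hδ0]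

/-- **Without non-degeneracy the crux HOLDS** (clauses (1)–(5), (7), (8) with `ρ(δ) = δ`, `Δ = 1` and the
trivial limit of `criticalCorr 3`). So (6) is load-bearing: with (3) it carries ALL the content. [folklore] -/
theorem existsContinuousLimit_without_nondeg_holds :
    ∃ (ρ : ℝ → ℝ) (Δ : ℝ) (S : CorrFamily 3), (∀ δ ∈ Set.Ioc (0:ℝ) 1, 0 < ρ δ) ∧ 0 < Δ ∧
      HasPointwiseScalingLimit (criticalCorr 3) ρ S ∧ (∀ n z, z ∉ NonCoincident 3 n → S n z = 0) ∧
      (∀ n, ContinuousOn (S n) (NonCoincident 3 n)) ∧ IsTranslationInvariant S ∧ IsScaleCovariant Δ S := by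
  refine ⟨fun δ => δ, 1, fun n _ => if n = 0 then 1 else 0, fun δ hδ => hδ.1, one_pos,
    hasPointwiseScalingLimit_trivial, ?_, ?_, ?_, ?_⟩
  · intro n z hz
    rcases Nat.eq_zero_or_pos n with rfl | hn
    · exact absurd (Function.injective_of_subsingleton z) hz
    · exact if_neg hn.ne'
  · intro n
    exact continuousOn_const
  · intro n v x
    rfl
  · intro n c hc x
    rcases Nat.eq_zero_or_pos n with rfl | hn
    · simp
    · simp [hn.ne']

/-! ### (3) is load-bearing: without the convergence clause the statement is TRUE (power family) -/

/-- Total pairwise distance is translation invariant. [folklore] -/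
theorem pairSum_translate {n : ℕ} (v : EuclideanSpace ℝ (Fin 3)) (x : Fin n → EuclideanSpace ℝ (Fin 3)) :
    (∑ i, ∑ j, ‖(x i + v) - (x j + v)‖) = ∑ i, ∑ j, ‖x i - x j‖ := by
  simp [add_sub_add_right_eq_sub]

/-- Total pairwise distance is `1`-homogeneous under dilations `c > 0`. [folklore] -/
theorem pairSum_smul {n : ℕ} {c : ℝ} (hc : 0 < c) (x : Fin n → EuclideanSpace ℝ (Fin 3)) :
    (∑ i, ∑ j, ‖c • x i - c • x j‖) = c * ∑ i, ∑ j, ‖x i - x j‖ := by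
  simp only [← smul_sub, norm_smul, Real.norm_eq_abs, abs_of_pos hc, Finset.mul_sum]

/-- On a non-coincident configuration of `n ≥ 2` points the total pairwise distance is positive. [folklore] -/
theorem pairSum_pos {n : ℕ} (hn : 2 ≤ n) {x : Fin n → EuclideanSpace ℝ (Fin 3)}
    (hx : x ∈ NonCoincident 3 n) : 0 < ∑ i, ∑ j, ‖x i - x j‖ := by
  obtain ⟨k, rfl⟩ : ∃ k, n = k + 2 := ⟨n - 2, by omega⟩
  rw [mem_nonCoincident] at hx
  have hij : (0 : Fin (k + 2)) ≠ 1 := Fin.zero_ne_one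
  have hne : x 0 ≠ x 1 := fun h => hij (hx h)
  have hpos : 0 < ‖x 0 - x 1‖ := norm_pos_iff.2 (sub_ne_zero.2 hne)
  have h1 : ‖x 0 - x 1‖ ≤ ∑ j, ‖x 0 - x j‖ :=
    Finset.single_le_sum (f := fun j => ‖x 0 - x j‖) (fun _ _ => norm_nonneg _) (Finset.mem_univ 1)
  have h2 : ∑ j, ‖x 0 - x j‖ ≤ ∑ i, ∑ j, ‖x i - x j‖ :=
    Finset.single_le_sum (f := fun i => ∑ j, ‖x i - x j‖)
      (fun _ _ => Finset.sum_nonneg fun _ _ => norm_nonneg _) (Finset.mem_univ 0)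
  exact hpos.trans_le (h1.trans h2)

/-- On at most one point the total pairwise distance vanishes. [folklore] -/
theorem pairSum_eq_zero_of_lt_two {n : ℕ} (hn : n < 2) (x : Fin n → EuclideanSpace ℝ (Fin 3)) :
    (∑ i, ∑ j, ‖x i - x j‖) = 0 := by
  interval_cases n <;> simp

/-- The total pairwise distance is continuous in the configuration. [folklore] -/
theorem continuous_pairSum {n : ℕ} :
    Continuous fun x : Fin n → EuclideanSpace ℝ (Fin 3) => ∑ i, ∑ j, ‖x i - x j‖ :=
  continuous_finsetSum _ fun i _ => continuous_finsetSum _ fun j _ =>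
    ((continuous_apply i).sub (continuous_apply j)).norm

/-- **Without the convergence clause the crux HOLDS**: the power family
`Sₙ(x) = (∑ᵢⱼ ‖xᵢ − xⱼ‖)^{−nΔ}` on `NonCoincident`, `0` elsewhere (`ρ ≡ 1`, `Δ = 1`) satisfies every other
clause — so (3) is load-bearing, and the seven non-limit clauses are mutually consistent (a non-junk model
of the clause bundle). [folklore] -/
theorem existsContinuousLimit_without_limit_holds :
    ∃ (ρ : ℝ → ℝ) (Δ : ℝ) (S : CorrFamily 3), (∀ δ ∈ Set.Ioc (0:ℝ) 1, 0 < ρ δ) ∧ 0 < Δ ∧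
      (∀ n z, z ∉ NonCoincident 3 n → S n z = 0) ∧ (∀ n, ContinuousOn (S n) (NonCoincident 3 n)) ∧
      IsNondegenerateTwoPoint S ∧ IsTranslationInvariant S ∧ IsScaleCovariant Δ S := by
  refine ⟨fun _ => 1, 1,
    fun n x => if x ∈ NonCoincident 3 n then (∑ i, ∑ j, ‖x i - x j‖) ^ (-(n : ℝ) * 1) else 0,
    fun _ _ => one_pos, one_pos, ?_, ?_, ?_, ?_, ?_⟩
  · intro n z hz
    exact if_neg hz
  · intro n
    have hcont : ContinuousOn
        (fun x : Fin n → EuclideanSpace ℝ (Fin 3) => (∑ i, ∑ j, ‖x i - x j‖) ^ (-(n : ℝ) * 1))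
        (NonCoincident 3 n) := by
      rcases lt_or_ge n 2 with hn | hn
      · simp_rw [pairSum_eq_zero_of_lt_two hn]
        exact continuousOn_const
      · exact continuous_pairSum.continuousOn.rpow_const fun x hx => Or.inl (pairSum_pos hn hx).ne'
    exact hcont.congr fun x hx => if_pos hx
  · intro x hx
    beta_reduce
    rw [if_pos hx]
    exact Real.rpow_pos_of_pos (pairSum_pos le_rfl hx) _
  · intro n v x
    simp only [add_mem_nonCoincident_iff, pairSum_translate]
  · intro n c hc x
    simp only [smul_mem_nonCoincident_iff hc.ne', pairSum_smul hc]
    split_ifs with hx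
    · exact Real.mul_rpow hc.le (Finset.sum_nonneg fun _ _ => Finset.sum_nonneg fun _ _ => norm_nonneg _)
    · exact (mul_zero _).symm

/-- **The load-bearing summary.** Clauses (3) "the limit exists" and (6) "it is non-degenerate" are the only
content of `ExistsContinuousLimit`: each of the other six can be dropped without changing the statement,
and each of (3), (6) alone — with all six idle clauses — is satisfiable outright. [folklore] -/
theorem existsContinuousLimit_loadBearing :
    (ReflectionTwin.ExistsContinuousLimit ↔
      ∃ (ρ : ℝ → ℝ) (S : CorrFamily 3), HasPointwiseScalingLimit (criticalCorr 3) ρ S ∧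
        IsNondegenerateTwoPoint S) ∧
    (∃ (ρ : ℝ → ℝ) (Δ : ℝ) (S : CorrFamily 3), (∀ δ ∈ Set.Ioc (0:ℝ) 1, 0 < ρ δ) ∧ 0 < Δ ∧
      HasPointwiseScalingLimit (criticalCorr 3) ρ S ∧ (∀ n z, z ∉ NonCoincident 3 n → S n z = 0) ∧
      (∀ n, ContinuousOn (S n) (NonCoincident 3 n)) ∧ IsTranslationInvariant S ∧ IsScaleCovariant Δ S) ∧
    (∃ (ρ : ℝ → ℝ) (Δ : ℝ) (S : CorrFamily 3), (∀ δ ∈ Set.Ioc (0:ℝ) 1, 0 < ρ δ) ∧ 0 < Δ ∧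
      (∀ n z, z ∉ NonCoincident 3 n → S n z = 0) ∧ (∀ n, ContinuousOn (S n) (NonCoincident 3 n)) ∧
      IsNondegenerateTwoPoint S ∧ IsTranslationInvariant S ∧ IsScaleCovariant Δ S) :=
  ⟨⟨fun ⟨ρ, _, S, _, _, hlim, _, _, hnd, _, _⟩ => ⟨ρ, S, hlim, hnd⟩,
    fun ⟨_, _, hlim, hnd⟩ => existsContinuousLimit_iff_core.2 (core_of_limit_nondeg hlim hnd)⟩,
    existsContinuousLimit_without_nondeg_holds, existsContinuousLimit_without_limit_holds⟩

end Summit.CriticalPhenomena.Ising3DConformalLimit.ExistsContinuousLimitNegative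

end
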